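import Summits.QuantumFields.BalabanUV.T4Continuum.Support.NE7ConvOneStepEnd
import HarnessLib

/-!
# NE7ConvOneStepWeighted — CONV-ONE-STEP IN ROUTE Π's WEIGHTED CURRENCY: the two normal letters measured against the η-WEIGHTED ENERGY NORM
# `‖X‖_w² = curlSq U♯ X + (L^k)^{−2}·dirSq X` of row NE3 (`NE3EnergyWeightedShapes.energyNormW`) — `‖X_N‖_w ≤ ν‖X‖_w` and `a·Σ‖d_{U♯}X_N‖ ≤ κ₁‖X‖_w²`,
# the SIZES 1–2 of route Π's `NE3ProductPathChart.DecomposedRep` — under ONE numeric line that is MANIFESTLY k-FREE at the natural scales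

Cell `pub-balaban`, rung (B)+1 sub-cell t4, lineage `b2b-balaban-t4-ne7-p1`, generation 66 (CRUX PROVER NE7 #1); hunt (h10) «ONE-STEP = CRIT ∧ CONV»,
memo `t4/b2b-balaban-t4-ne7-p1-g66/HUNT-H10-TWO-ROADS.md` §2.  File F9 (over F1–F4; the junction of CONV-ONE-STEP with row NE3's route Π).

WHY.  F4 `NE7ConvOneStepEnd.isMinimiser_of_critical_rep` measures the normal part `X_N` of a competitor's representative against `dirSq X` (`θ`, `C_N`), so
its numeric line carries `(L^k)^{−2}` against `θ`, `C_N` and is k-uniform only after the suppliers' scales are inserted (memo §2 (c)).  Row NE3's route Π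
supplies the normal part's sizes in the η-weighted energy norm (`DecomposedRep.nwN`: `‖N‖_w ≤ ν‖X‖_w`; `.curlN`: `a·Σ‖curl_W N‖ ≤ κ₁‖X‖_w²`), in which
(P♮) reads `(L^k)^{−2}·dirSq X_T ≤ C·curlSq U♯ X_T` ⟹ `‖X_T‖_w² ≤ (1 + C)·curlSq U♯ X_T`.  THIS FILE re-runs F3∕F4 in that currency:
§1 **`curlSq_ge_weighted`** — split `X = X_T + X_N`, `X_T ∈ T` with `SlicePoincare L k U♯ T C F`, `‖X_N‖_w² ≤ ν²·‖X‖_w²` ⟹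
   `m_E·‖X‖_w² ≤ curlSq U♯ X F`, `m_E = (1∕2 − ν²)∕(2(1 + C)) − ν²` (no bond count, no periodicity);
§2 **`hess_vary_ge_weighted`** — with `‖X(b)‖ ≤ α`, the radius `a′` of `U♯e^{tX}` and the torus bond count:
   `((m_E∕2 − 576d(e^α − 1)²(L^k)²)∕card n − 28d·a′·(L^k)²)·‖X‖_w² ≤ hess (U♯e^{tX}) X X (plaqsOf (periodBox M))` on `[0,1]`;
§3 **`isMinimiser_of_critical_rep_weighted`** — `U♯ ∈ admissible 𝒞 L k V` unitary, `SmallField U♯ a` (`a ≥ 0`), critical on a Poincaré slice `T`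
   (`SlicePoincare L k U♯ T C (periodBox (N·L^k))`, `C > 0`); every admissible `U′` represented by a skew `(N·L^k)`-periodic `X` (`‖X‖_∞ ≤ α`,
   `levelAction (U♯e^X) ≤ levelAction U′`, `SmallField (U♯e^X) a`) with a split `X = X_T + X_N`, `X_T ∈ T`, `X_N` skew, and the WEIGHTED SIZES
   `energyNormW L k U♯ X_N F ≤ ν·energyNormW L k U♯ X F` (`0 ≤ ν`), `a·Σ_{perWin}‖(d_{U♯}X_N)(p)‖ ≤ κ₁·energyNormW L k U♯ X F²`, under the line
   `2κ₁ ≤ (m_E∕2 − 576d(e^α − 1)²(L^k)²)∕card n − 28d(a + 7α²)(L^k)²`  ⟹ `IsMinimiser d 𝒞 L N k V U♯`.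
   At the natural scales `a = ε(L^k)^{−2}`, `α = c·εL^{−k}` every term of the line is a k-FREE function of `(ε, ν, C, card n, d)`:
   `2κ₁ ≤ ((1∕2 − ν²)∕(4(1+C)) − ν²∕2 − 576d·c²ε²·(1 + o(1)))∕card n − 28d(ε + 7c²ε²)` — the form in which row NE3's k-free letters (ν, κ₁ of
   `decomposedRep_of_linearNormalPart` ∕ `_of_quadLetter`) can be inserted for the pair (`U♯`, `U′`) once a Π-type supplier exists for it.
HONEST FRAMING (page 1): [folklore] bookkeeping over HYPOTHESES (REP with weighted sizes, criticality, (P♮)); nothing is asserted about Bałaban's minimisers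
or about route Π's suppliers (which serve the pair (U_A, U_B) of NE3, not this pair); NOT ONE-STEP, NOT NE7; spine 0∕9; finite T⁴ rung (B)+1 — NOT infinite
volume, NOT mass gap, NOT Clay.  Continuum YM on T⁴ ⇐ BetaPertH ∧ nine spine estimates (0/9 proved); BetaPertH ⇐ (D1) ∧ (D4) ∧ CAP+tail; G-an2-4 gates
asym, D1 and NE2/3/4.
-/

set_option autoImplicit false

open scoped BigOperators Matrix.Norms.L2Operator
open NormedSpace Finset Set

namespace Summit.QuantumFields.BalabanUV.T4Continuum.NE7ConvOneStepWeighted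

open Literature.MathematicalPhysics.QuantumFieldTheory.Balaban1983to89
open B7Prop1Explicit B7Prop2Explicit MatrixLog UnitaryModel
open T4AveragingDeficitWall (IsUnitaryCfg IsSkewDir SmallField fineAction vary curl curlSq dirSq)
open T4AveragingDeficitWallBoundary (IsPeriodicCfg periodBox)
open AveragingDeficitPeriodicCounting (IsPeriodicDir)
open MinimalActionLevels (levelAction perWin)
open MinimalActionSandwich (IsMinimiser admissible)
open NE3HessForm (hess dAction)
open NE3HessBounds (bondSq)
open NE3HessShapes (plaqsOf sum_plaqsOf_bondSq_le curlSq_eq_sum_plaqsOf)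
open NE3CurlStability (hess_self_ge_vary)
open NE3SlicePoincareShape (SlicePoincare)
open NE3EnergyWeightedShapes (energyNormW energyNormW_nonneg)
open NE3WeightedCoercivityTransfer (energyNormW_sq)
open NE3EnergyHessContTwoTerm (curlSq_nonneg dirSq_nonneg)
open NE7OneStepOfCritical (isMinimiser_of_segmentData)
open NE7SegmentPlaquetteRadius (smallField_vary_segment_class)
open NE7OneStepLetters (dAction_ge_of_tangent_critical curlSq_add_ge dirSq_add_ge)

noncomputable section

variable {d : ℕ} {n : Type*} [Fintype n] [DecidableEq n]

/-! ## §1 The Poincaré letter in the weighted currency -/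

/-- `curlSq U (−Y) F = curlSq U Y F`. [folklore] -/
theorem curlSq_neg (U : Site d → Fin d → (Matrix n n ℂ)ˣ) (Y : Site d → Fin d → Matrix n n ℂ) (F : Finset (Site d)) :
    curlSq U (-Y) F = curlSq U Y F := by
  have h : (-Y) = (-1 : ℝ) • Y := by funext x κ; simp
  rw [h, curlSq_eq_sum_plaqsOf, curlSq_eq_sum_plaqsOf]
  refine Finset.sum_congr rfl fun p _ => ?_
  rw [NE7ExactCurrent.curl_smul, norm_smul, Real.norm_eq_abs, abs_neg, abs_one, one_mul]

/-- `dirSq (−Y) F = dirSq Y F`. [folklore] -/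
theorem dirSq_neg' (Y : Site d → Fin d → Matrix n n ℂ) (F : Finset (Site d)) : dirSq (-Y) F = dirSq Y F := by
  unfold dirSq; simp only [Pi.neg_apply, norm_neg]

/-- **THE WEIGHTED POINCARÉ LETTER**: split `X = X_T + X_N` with `X_T ∈ T`, `SlicePoincare L k U T C F` (`C ≥ 0`) and
`‖X_N‖_w² ≤ ν²·‖X‖_w²` ⟹ `((1∕2 − ν²)∕(2(1+C)) − ν²)·‖X‖_w² ≤ curlSq U X F`. [folklore] -/
theorem curlSq_ge_weighted {L k : ℕ} {U : Site d → Fin d → (Matrix n n ℂ)ˣ} {T : Set (Site d → Fin d → Matrix n n ℂ)} {C : ℝ} (hC : 0 ≤ C)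
    {F : Finset (Site d)} (hP : SlicePoincare L k U T C F) {X XT XN : Site d → Fin d → Matrix n n ℂ} (hsplit : X = XT + XN) (hXT : XT ∈ T)
    {ν : ℝ} (hN : energyNormW L k U XN F ^ 2 ≤ ν ^ 2 * energyNormW L k U X F ^ 2) :
    ((1 / 2 - ν ^ 2) / (2 * (1 + C)) - ν ^ 2) * energyNormW L k U X F ^ 2 ≤ curlSq U X F := by
  have hPT0 := hP XT hXT
  have h1 := curlSq_add_ge U X (-XN) F
  have h2 := dirSq_add_ge X (-XN) F
  have hTeq : X + -XN = XT := by rw [hsplit]; abel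
  rw [hTeq, curlSq_neg] at h1
  rw [hTeq, dirSq_neg'] at h2
  have h3 := curlSq_add_ge U XT XN F
  rw [← hsplit] at h3
  rw [energyNormW_sq, energyNormW_sq] at hN
  rw [energyNormW_sq]
  have hw0 : 0 ≤ (((L : ℝ) ^ k)⁻¹) ^ 2 := sq_nonneg _
  have hdN0 : 0 ≤ dirSq XN F := dirSq_nonneg _ _
  have hcT0 : 0 ≤ curlSq U XT F := curlSq_nonneg _ _ _
  -- linear consequences (atoms: cX = curlSq X, cT, cN, dX = dirSq X, dT, dN, w = (L^k)⁻²)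
  have h4 : curlSq U XN F ≤ ν ^ 2 * curlSq U X F + ν ^ 2 * ((((L : ℝ) ^ k)⁻¹) ^ 2 * dirSq X F) := by
    have e0 : 0 ≤ (((L : ℝ) ^ k)⁻¹) ^ 2 * dirSq XN F := mul_nonneg hw0 hdN0
    have e3 : ν ^ 2 * (curlSq U X F + (((L : ℝ) ^ k)⁻¹) ^ 2 * dirSq X F)
        = ν ^ 2 * curlSq U X F + ν ^ 2 * ((((L : ℝ) ^ k)⁻¹) ^ 2 * dirSq X F) := by ring
    linarith
  have h5 : curlSq U X F / 2 + ((((L : ℝ) ^ k)⁻¹) ^ 2 * dirSq X F) / 2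
      - (ν ^ 2 * curlSq U X F + ν ^ 2 * ((((L : ℝ) ^ k)⁻¹) ^ 2 * dirSq X F)) ≤ curlSq U XT F + C * curlSq U XT F := by
    have e1 : (((L : ℝ) ^ k)⁻¹) ^ 2 * (dirSq X F / 2 - dirSq XN F) ≤ (((L : ℝ) ^ k)⁻¹) ^ 2 * dirSq XT F :=
      mul_le_mul_of_nonneg_left h2 hw0
    have e2 : (((L : ℝ) ^ k)⁻¹) ^ 2 * (dirSq X F / 2 - dirSq XN F)
        = ((((L : ℝ) ^ k)⁻¹) ^ 2 * dirSq X F) / 2 - (((L : ℝ) ^ k)⁻¹) ^ 2 * dirSq XN F := by ring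
    have e3 : ν ^ 2 * (curlSq U X F + (((L : ℝ) ^ k)⁻¹) ^ 2 * dirSq X F)
        = ν ^ 2 * curlSq U X F + ν ^ 2 * ((((L : ℝ) ^ k)⁻¹) ^ 2 * dirSq X F) := by ring
    linarith
  have h1C : 0 < 1 + C := by linarith
  have h6 : (curlSq U X F / 2 + ((((L : ℝ) ^ k)⁻¹) ^ 2 * dirSq X F) / 2
      - (ν ^ 2 * curlSq U X F + ν ^ 2 * ((((L : ℝ) ^ k)⁻¹) ^ 2 * dirSq X F))) / (1 + C) ≤ curlSq U XT F := by
    rw [div_le_iff₀ h1C]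
    have e : curlSq U XT F * (1 + C) = curlSq U XT F + C * curlSq U XT F := by ring
    linarith
  have h7 : ((1 / 2 - ν ^ 2) / (2 * (1 + C)) - ν ^ 2) * (curlSq U X F + (((L : ℝ) ^ k)⁻¹) ^ 2 * dirSq X F)
      = ((curlSq U X F / 2 + ((((L : ℝ) ^ k)⁻¹) ^ 2 * dirSq X F) / 2
          - (ν ^ 2 * curlSq U X F + ν ^ 2 * ((((L : ℝ) ^ k)⁻¹) ^ 2 * dirSq X F))) / (1 + C)) / 2
        - (ν ^ 2 * curlSq U X F + ν ^ 2 * ((((L : ℝ) ^ k)⁻¹) ^ 2 * dirSq X F)) := by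
    field_simp
  rw [h7]
  linarith

/-! ## §2 The convexity letter in the weighted currency -/

/-- **THE CONVEXITY LETTER, WEIGHTED**: for `L ≥ 1`, unitary `U`, skew `M`-periodic `X` (`M ≥ 1`) with `‖X(b)‖ ≤ α` (`α ≥ 0`), a weighted Poincaré
letter `m·‖X‖_w² ≤ curlSq U X (periodBox M)` and the radius `a′ ≥ 0` of `U e^{tX}`:
`((m∕2 − 576d(e^α − 1)²·(L^k)²)∕card n − 28d·a′·(L^k)²)·‖X‖_w² ≤ hess (U e^{tX}) X X (plaqsOf (periodBox M))` for `t ∈ [0,1]`. [folklore] -/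
theorem hess_vary_ge_weighted [Nonempty n] {L k M : ℕ} (hL : 1 ≤ L) (hM : 1 ≤ M) {U : Site d → Fin d → (Matrix n n ℂ)ˣ} (hU : IsUnitaryCfg U)
    {X : Site d → Fin d → Matrix n n ℂ} (hX : IsSkewDir X) (hXP : IsPeriodicDir X M) {α m a' : ℝ} (hα : 0 ≤ α)
    (hXα : ∀ x κ, ‖X x κ‖ ≤ α) (hm : m * energyNormW L k U X (periodBox (d := d) M) ^ 2 ≤ curlSq U X (periodBox (d := d) M))
    {t : ℝ} (ht : t ∈ Icc (0 : ℝ) 1) (ha' : 0 ≤ a') (hrad : SmallField (vary U X t) a') :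
    ((m / 2 - 576 * d * (Real.exp α - 1) ^ 2 * ((L : ℝ) ^ k) ^ 2) / (Fintype.card n : ℝ) - 28 * d * a' * ((L : ℝ) ^ k) ^ 2)
        * energyNormW L k U X (periodBox (d := d) M) ^ 2
      ≤ hess (vary U X t) X X (plaqsOf (periodBox (d := d) M)) := by
  obtain ⟨ht0, ht1⟩ := ht
  set E := energyNormW L k U X (periodBox (d := d) M) ^ 2 with hEdef
  have hLk : (0 : ℝ) < (L : ℝ) ^ k := pow_pos (by exact_mod_cast (show 0 < L by omega)) k
  have h := hess_self_ge_vary hU hX hXα t hX hrad (plaqsOf (periodBox (d := d) M))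
  have hb := sum_plaqsOf_bondSq_le (n := n) hM hXP
  rw [← curlSq_eq_sum_plaqsOf] at h
  have hN : (0 : ℝ) < Fintype.card n := Nat.cast_pos.mpr Fintype.card_pos
  have hD : 0 ≤ dirSq X (periodBox (d := d) M) := dirSq_nonneg _ _
  have hCq : 0 ≤ curlSq U X (periodBox (d := d) M) := curlSq_nonneg _ _ _
  have hB : 0 ≤ ∑ p ∈ plaqsOf (periodBox (d := d) M), bondSq X p := Finset.sum_nonneg fun p _ => by
    unfold bondSq NE3HessBounds.bondSqAt; positivity
  -- `dirSq X ≤ (L^k)²·E`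
  have hE : E = curlSq U X (periodBox (d := d) M) + (((L : ℝ) ^ k)⁻¹) ^ 2 * dirSq X (periodBox (d := d) M) := energyNormW_sq _ _ _ _ _
  have hLk0 : (L : ℝ) ^ k ≠ 0 := hLk.ne'
  have hDE : dirSq X (periodBox (d := d) M) ≤ ((L : ℝ) ^ k) ^ 2 * E := by
    have : ((L : ℝ) ^ k) ^ 2 * E = ((L : ℝ) ^ k) ^ 2 * curlSq U X (periodBox (d := d) M) + dirSq X (periodBox (d := d) M) := by
      rw [hE]; field_simp
    rw [this]
    have : 0 ≤ ((L : ℝ) ^ k) ^ 2 * curlSq U X (periodBox (d := d) M) := mul_nonneg (sq_nonneg _) hCq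
    linarith
  have hd0 : (0 : ℝ) ≤ d := Nat.cast_nonneg d
  have hbE : ∑ p ∈ plaqsOf (periodBox (d := d) M), bondSq X p ≤ 4 * d * (((L : ℝ) ^ k) ^ 2 * E) :=
    hb.trans (mul_le_mul_of_nonneg_left hDE (by linarith))
  -- `(e^{|t|α} − 1)² ≤ (e^{α} − 1)²` on `[0,1]`
  have hexp : (Real.exp (|t| * α) - 1) ^ 2 ≤ (Real.exp α - 1) ^ 2 := by
    rw [abs_of_nonneg ht0]
    have h1 : Real.exp (t * α) ≤ Real.exp α := Real.exp_le_exp.mpr (by nlinarith)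
    have h2 : 1 ≤ Real.exp (t * α) := Real.one_le_exp (mul_nonneg ht0 hα)
    nlinarith
  -- assemble
  have hnum : (m * E) / 2 - 144 * (Real.exp α - 1) ^ 2 * (4 * d * (((L : ℝ) ^ k) ^ 2 * E))
      ≤ curlSq U X (periodBox (d := d) M) / 2 - 144 * (Real.exp (|t| * α) - 1) ^ 2 * ∑ p ∈ plaqsOf (periodBox (d := d) M), bondSq X p := by
    have e1 : 144 * (Real.exp (|t| * α) - 1) ^ 2 * ∑ p ∈ plaqsOf (periodBox (d := d) M), bondSq X p
        ≤ 144 * (Real.exp α - 1) ^ 2 * (4 * d * (((L : ℝ) ^ k) ^ 2 * E)) := by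
      have := mul_le_mul hexp hbE hB (sq_nonneg _)
      linarith
    linarith
  have hdiv := div_le_div_of_nonneg_right hnum hN.le
  have e2 : 7 * a' * ∑ p ∈ plaqsOf (periodBox (d := d) M), bondSq X p ≤ 7 * a' * (4 * d * (((L : ℝ) ^ k) ^ 2 * E)) :=
    mul_le_mul_of_nonneg_left hbE (by linarith)
  have e3 : ((m / 2 - 576 * d * (Real.exp α - 1) ^ 2 * ((L : ℝ) ^ k) ^ 2) / (Fintype.card n : ℝ) - 28 * d * a' * ((L : ℝ) ^ k) ^ 2) * E
      = ((m * E) / 2 - 144 * (Real.exp α - 1) ^ 2 * (4 * d * (((L : ℝ) ^ k) ^ 2 * E))) / (Fintype.card n : ℝ)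
          - 7 * a' * (4 * d * (((L : ℝ) ^ k) ^ 2 * E)) := by
    field_simp
    ring
  rw [e3]
  linarith

/-! ## §3 CONV-ONE-STEP with route Π's weighted sizes -/

/-- **CONV-ONE-STEP WITH THE WEIGHTED SIZES OF THE NORMAL PART.**  See the module docstring, §3 (`L, N ≥ 1`). [folklore] -/
theorem isMinimiser_of_critical_rep_weighted [Nonempty n] {𝒞 : ℕ → Set (Site d → Fin d → (Matrix n n ℂ)ˣ)} {L N k : ℕ} (hL : 1 ≤ L)
    (hN : 1 ≤ N) {V Us : Site d → Fin d → (Matrix n n ℂ)ˣ} (hmem : Us ∈ admissible 𝒞 L k V) (hUs : IsUnitaryCfg Us) {a : ℝ} (ha : 0 ≤ a)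
    (hUsa : SmallField Us a) {T : Set (Site d → Fin d → Matrix n n ℂ)} {C : ℝ} (hC : 0 < C)
    (hP : SlicePoincare L k Us T C (periodBox (d := d) (N * L ^ k)))
    (hcrit : ∀ Y ∈ T, dAction Us Y (perWin d (N * L ^ k)) = 0)
    (hrep : ∀ U' ∈ admissible 𝒞 L k V, ∃ (X XT XN : Site d → Fin d → Matrix n n ℂ) (α ν κ₁ : ℝ),
      IsSkewDir X ∧ IsPeriodicDir X ((N * L ^ k : ℕ) : ℤ) ∧ 0 ≤ α ∧ (∀ x μ, ‖X x μ‖ ≤ α) ∧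
      levelAction d L N k (vary Us X 1) ≤ levelAction d L N k U' ∧ SmallField (vary Us X 1) a ∧
      X = XT + XN ∧ XT ∈ T ∧ IsSkewDir XN ∧ 0 ≤ ν ∧
      energyNormW L k Us XN (periodBox (d := d) (N * L ^ k)) ≤ ν * energyNormW L k Us X (periodBox (d := d) (N * L ^ k)) ∧
      a * (∑ p ∈ perWin d (N * L ^ k), ‖curl Us XN p‖) ≤ κ₁ * energyNormW L k Us X (periodBox (d := d) (N * L ^ k)) ^ 2 ∧
      2 * κ₁ ≤ ((((1 / 2 - ν ^ 2) / (2 * (1 + C)) - ν ^ 2) / 2 - 576 * d * (Real.exp α - 1) ^ 2 * ((L : ℝ) ^ k) ^ 2) / (Fintype.card n : ℝ)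
          - 28 * d * (a + 7 * α ^ 2) * ((L : ℝ) ^ k) ^ 2)) :
    IsMinimiser d 𝒞 L N k V Us := by
  have hN0 : 0 < N := hN
  have hL0 : 0 < L := hL
  have hM : 0 < N * L ^ k := Nat.mul_pos hN0 (Nat.pow_pos hL0)
  have e : perWin d (N * L ^ k) = plaqsOf (periodBox (d := d) (N * L ^ k)) := rfl
  refine isMinimiser_of_segmentData hL hmem fun U' hU' => ?_
  obtain ⟨X, XT, XN, α, ν, κ₁, hXs, hXP, hα, hXα, hle, h1, hsplit, hXT, hXNs, hν, hNw, hN1, hline⟩ := hrep U' hU'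
  set E := energyNormW L k Us X (periodBox (d := d) (N * L ^ k)) ^ 2 with hEdef
  have hE0 : 0 ≤ E := by rw [hEdef]; exact sq_nonneg _
  set cE := (((1 / 2 - ν ^ 2) / (2 * (1 + C)) - ν ^ 2) / 2 - 576 * d * (Real.exp α - 1) ^ 2 * ((L : ℝ) ^ k) ^ 2) / (Fintype.card n : ℝ)
      - 28 * d * (a + 7 * α ^ 2) * ((L : ℝ) ^ k) ^ 2 with hcE
  -- the weighted size 1, squared
  have hNw2 : energyNormW L k Us XN (periodBox (d := d) (N * L ^ k)) ^ 2 ≤ ν ^ 2 * E := by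
    have h0 := energyNormW_nonneg L k Us XN (periodBox (d := d) (N * L ^ k))
    calc energyNormW L k Us XN (periodBox (d := d) (N * L ^ k)) ^ 2
        ≤ (ν * energyNormW L k Us X (periodBox (d := d) (N * L ^ k))) ^ 2 := pow_le_pow_left₀ h0 hNw 2
      _ = ν ^ 2 * E := by rw [hEdef]; ring
  -- the weighted Poincaré letter and the convexity letter along the segment
  have hm := curlSq_ge_weighted hC.le hP hsplit hXT hNw2
  have hrad : ∀ t ∈ Icc (0 : ℝ) 1, SmallField (vary Us X t) (a + 7 * α ^ 2) := fun t ht => smallField_vary_segment_class hUs hXs hUsa h1 hXα ht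
  have ha' : 0 ≤ a + 7 * α ^ 2 := add_nonneg ha (mul_nonneg (by norm_num) (sq_nonneg α))
  have hconv : ∀ t ∈ Icc (0 : ℝ) 1, cE * E ≤ hess (vary Us X t) X X (perWin d (N * L ^ k)) := by
    intro t ht
    rw [e]
    exact hess_vary_ge_weighted hL hM hUs hXs hXP hα hXα hm ht ha' (hrad t ht)
  -- the slop from criticality on the tangent part and the weighted size 2
  have hleft : -(κ₁ * E) ≤ dAction Us X (perWin d (N * L ^ k)) := by
    have h := dAction_ge_of_tangent_critical hUs hUsa hsplit hXNs (perWin d (N * L ^ k)) (hcrit XT hXT)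
    linarith
  refine ⟨X, cE * E, κ₁ * E, hle, ?_, hconv, hleft⟩
  have := mul_le_mul_of_nonneg_right hline hE0
  linarith

end

end Summit.QuantumFields.BalabanUV.T4Continuum.NE7ConvOneStepWeighted
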